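import Literature.NumberTheory.LFunctions.RiemannHypothesisUpToRSCertificate
import HarnessLib

/-!
# Sign runs of Hardy's `Z` certified by Euler–Maclaurin alone (unconditional variant of the
# Riemann–Siegel certificate format)

Topic `Literature/NumberTheory/LFunctions` (with `Analysis/ValidatedNumerics`). The certificate format
`Literature/NumberTheory/LFunctions/RiemannHypothesisUpToRSCertificate.lean` certifies the signs of
`Z` along sample runs either by the Riemann–Siegel evaluator (conditional on Gabcke's remainder
bound `Literature.NumberTheory.LFunctions.Gabcke.satz322b_R0`) or by the kernel-oriented
Euler–Maclaurin evaluator `Literature.NumberTheory.LFunctions.ZetaNumerics.zetaBoxK` (every power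
`n^{-s}` afresh). For COMPILED evaluation (`native_decide`) the original evaluator
`Literature.NumberTheory.LFunctions.ZetaNumerics.zetaBox` (`ZetaCertifiedEvaluation.lean`: powers
only at the primes, products at composites via `Nat.minFac`) is several times faster and makes an
UNCONDITIONAL certificate affordable at heights `T ≈ 10⁴` (about `0.1 s` per sample with
`N = 2400`, `ν = 20`): this file adds that sign method and the corresponding run checks, reusing
the run semantics `Literature.NumberTheory.LFunctions.RSCert.AltRun`, the composition
`altRun_append` and the assembly `zetaZerosSimpleOnLineUpTo_of_runs` unchanged.

* `signEMF` — the sign of `Z(p/2^e)` from `zetaBox` and the rotation by the Stirling main term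
  (`hardyZ_pos_of_re_pos`, `|ϑ − ϑ_m| ≤ 2K(¼)/t < π/2`); soundness `sgnZ_of_signEMF` (no named
  fact).
* `checkGapsF`, `checkChunkF`, `checkStartF` and `altRun_of_checkChunkF`, `sgnZ_of_checkStartF` —
  runs of gaps all certified by `signEMF`.

Everything here is proved and unconditional; no data.

## References

* H. M. Edwards, *Riemann's Zeta Function* (1974), §6.4–6.5, §8.2. [EdwardsZeta1974]
* R. P. Brent, Math. Comp. 33 (1979), §3. [Brent1979]
-/

open Complex
open Literature.Analysis.ValidatedNumerics Literature.Analysis.ValidatedNumerics.NumericsMP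
open Literature.NumberTheory.LFunctions Literature.NumberTheory.LFunctions.ZetaNumerics
open Literature.NumberTheory.LFunctions.RSEval
open scoped Real

namespace Literature.NumberTheory.LFunctions.RSCert

/-! ## 1. The Euler–Maclaurin sign with the prime-factorised power table -/

/-- The sign of `Z(p/2^e)` by Euler–Maclaurin (`zetaBox`, powers only at primes) and rotation:
`Re(e^{iϑ_m} ζ(½ + it)) ≷ 0` with `|ϑ − ϑ_m| ≤ 2K(¼)/t < π/2` gives the sign of `Z(t)`.
[cite: EdwardsZeta1974, §6.5] -/
def signEMF (R : RSTables) (T : Tables) (e p : ℕ) : Option Bool :=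
  let S := R.T.S
  let tI := MI.ofFrac S p (2 ^ e)
  if 2 * 2 ^ e ≤ p ∧ T.S = S then
    match thetaMainBox R e p, zetaBox T ⟨MI.ofFrac S 1 2, tI⟩, MI.divPos S R.twoK tI with
    | some thm, some Zb, some dl =>
      match MC.expI S R.T.KI R.T.kI R.T.piI thm with
      | some E =>
        let w := (MC.mul S E Zb).re
        if 2 * dl.hi < R.T.piI.lo then
          (if 0 < w.lo then some true else if w.hi < 0 then some false else none)
        else none
      | none => none
    | _, _, _ => none
  else none

/-- Soundness of `signEMF` (unconditional). [cite: EdwardsZeta1974, §6.5] -/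
theorem sgnZ_of_signEMF {R : RSTables} (hR : R.Valid) {T : Tables} (hT : T.Valid) {e p : ℕ}
    {s : Bool} (h : signEMF R T e p = some s) : sgnZ e p s := by
  have hS := hR.T_valid.S_pos
  have hpi := hR.T_valid.mem_pi
  unfold signEMF at h
  simp only at h
  split_ifs at h with hc
  obtain ⟨h2, hTS⟩ := hc
  set t : ℝ := (p : ℝ) / 2 ^ e with ht
  have h2e : (0 : ℝ) < 2 ^ e := by positivity
  have ht2 : 2 ≤ t := by
    rw [ht, le_div_iff₀ h2e]
    have : ((2 * 2 ^ e : ℕ) : ℝ) ≤ p := by exact_mod_cast h2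
    push_cast at this; exact this
  have hp1 : 1 ≤ p := by
    by_contra hp; push Not at hp; interval_cases p; simp [ht] at ht2; linarith
  have htI : MI.mem R.T.S t (MI.ofFrac R.T.S p (2 ^ e)) := by
    have := MI.mem_ofFrac R.T.S (p : ℤ) (q := 2 ^ e) (by positivity)
    have e1 : ((p : ℤ) : ℝ) / ((2 ^ e : ℕ) : ℝ) = t := by rw [ht]; push_cast; ring
    rwa [e1] at this
  -- common facts
  have hsB : MC.mem T.S (1 / 2 + (t : ℂ) * I) ⟨MI.ofFrac R.T.S 1 2, MI.ofFrac R.T.S p (2 ^ e)⟩ := by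
    rw [hTS]
    refine ⟨?_, ?_⟩
    · have := MI.mem_ofFrac R.T.S 1 (q := 2) (by norm_num)
      simp only [add_re, one_div, mul_re, ofReal_re, I_re, mul_zero, ofReal_im, I_im,
        mul_one, sub_self, add_zero]
      convert this using 2; simp
    · simpa using htI
  have hne : (1 / 2 : ℂ) + (t : ℂ) * I ≠ 1 := fun h ↦ by
    have := congrArg Complex.im h; simp at this; linarith
  set θm : ℝ := t / 2 * Real.log (t / (2 * π)) - t / 2 - π / 8 with hθm
  have hθ : |θm - riemannSiegelTheta t| ≤ 2 * stirlingVertRate (1 / 4) / t := by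
    rw [abs_sub_comm]
    have := abs_riemannSiegelTheta_sub_stirling_le (t := t) ht2
    rwa [← hθm] at this
  split at h
  · rename_i thm Zb dl hthm hZb hdl
    have hthm' : MI.mem R.T.S θm thm := mem_thetaMainBox hR hp1 hthm
    have hZ := mem_zetaBox hT hsB hne hZb
    rw [hTS] at hZ
    have hdl' : MI.mem R.T.S (2 * stirlingVertRate (1 / 4) / t) dl :=
      MI.mem_divPos hS hdl hR.mem_twoK htI
    split at h
    · rename_i E hE
      have hE' := MC.mem_expI hS hpi hE hthm'
      have hw := (MC.mem_mul hS hE' hZ).1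
      split_ifs at h with hang h1 h2
      · simp only [Option.some.injEq] at h
        subst h
        simp only [sgnZ, if_true]
        have hlt : 2 * stirlingVertRate (1 / 4) / t < π / 2 := by
          have a1 := hdl'.2
          have a2 := hpi.1
          have a3 : (2 : ℝ) * dl.hi < R.T.piI.lo := by exact_mod_cast hang
          nlinarith
        exact hardyZ_pos_of_re_pos (φ := θm) (lt_of_le_of_lt hθ hlt) (MI.pos_of_lo_pos hw h1)
      · simp only [Option.some.injEq] at h
        subst h
        simp only [sgnZ, Bool.false_eq_true, ↓reduceIte]
        have hlt : 2 * stirlingVertRate (1 / 4) / t < π / 2 := by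
          have a1 := hdl'.2
          have a2 := hpi.1
          have a3 : (2 : ℝ) * dl.hi < R.T.piI.lo := by exact_mod_cast hang
          nlinarith
        exact hardyZ_neg_of_re_neg (φ := θm) (lt_of_le_of_lt hθ hlt) (MI.neg_of_hi_neg hw h2)
    · simp at h
  · simp at h

/-! ## 2. Runs certified by `signEMF` -/

/-- Check a list of gaps from the point `p` with known sign `s`, every sign by `signEMF`.
[cite: Brent1979, §3] -/
def checkGapsF (R : RSTables) (T : Tables) (e : ℕ) : ℕ → Bool → List ℕ → Option (ℕ × Bool)
  | p, s, [] => some (p, s)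
  | p, s, g :: gs =>
    if 0 < g ∧ signEMF R T e (p + g) = some (!s) then checkGapsF R T e (p + g) (!s) gs else none

/-- Soundness of `checkGapsF`. [cite: Brent1979, §3] -/
theorem altRun_of_checkGapsF {R : RSTables} (hR : R.Valid) {T : Tables} (hT : T.Valid) {e : ℕ} :
    ∀ (gs : List ℕ) (p : ℕ) (s : Bool) {p' : ℕ} {s' : Bool},
    sgnZ e p s → checkGapsF R T e p s gs = some (p', s') →
      AltRun e p s gs ∧ p + gs.sum = p' ∧ sgnZ e p' s'
  | [], p, s, p', s', hp, h => by
    simp only [checkGapsF, Option.some.injEq, Prod.mk.injEq] at h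
    obtain ⟨rfl, rfl⟩ := h
    exact ⟨hp, by simp, hp⟩
  | g :: gs, p, s, p', s', hp, h => by
    simp only [checkGapsF] at h
    split_ifs at h with hc
    obtain ⟨hg, hsg⟩ := hc
    have hnext := sgnZ_of_signEMF hR hT hsg
    obtain ⟨hrun, hsum, hlast⟩ := altRun_of_checkGapsF hR hT gs (p + g) (!s) hnext h
    exact ⟨⟨hp, hg, hrun⟩, by simp [List.sum_cons, ← hsum, add_assoc], hlast⟩

/-- **The Euler–Maclaurin chunk check** with tables built inside (`RSEval.rsTablesWith 8` for the
rotation constants, Euler–Maclaurin tables of cut-off `Nem` and order `ν`, scale `2^60`): from the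
point `p` with known sign `s`, check the gaps `gs`. [cite: Brent1979, §3] -/
def checkChunkF (Nem nu e p : ℕ) (s : Bool) (gs : List ℕ) : Option (ℕ × Bool) :=
  match rsTablesWith 8, RHUpToCert.tablesWith Nem nu with
  | some R, some T => checkGapsF R T e p s gs
  | _, _ => none

/-- The start check by `signEMF`. [cite: Brent1979, §3] -/
def checkStartF (Nem nu e p : ℕ) (s : Bool) : Bool :=
  match rsTablesWith 8, RHUpToCert.tablesWith Nem nu with
  | some R, some T => decide (signEMF R T e p = some s)
  | _, _ => false

/-- Soundness of `checkStartF` (unconditional). [cite: Brent1979, §3] -/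
theorem sgnZ_of_checkStartF {Nem nu e p : ℕ} {s : Bool} (h : checkStartF Nem nu e p s = true) :
    sgnZ e p s := by
  unfold checkStartF at h
  split at h
  · rename_i R T hR hT
    exact sgnZ_of_signEMF (rsTablesWith_valid hR) (RHUpToCert.tablesWith_valid hT) (of_decide_eq_true h)
  · simp at h

/-- **Soundness of the Euler–Maclaurin chunk check** (unconditional): from a certified sign `s` at
`p`, `checkChunkF … p s gs = some (p', s')` gives the run `AltRun e p s gs`, ending at
`p' = p + Σ gs` with certified sign `s'`. [cite: Brent1979, §3] -/
theorem altRun_of_checkChunkF {Nem nu e p : ℕ} {s : Bool} {gs : List ℕ} {p' : ℕ} {s' : Bool}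
    (hp : sgnZ e p s) (h : checkChunkF Nem nu e p s gs = some (p', s')) :
    AltRun e p s gs ∧ p + gs.sum = p' ∧ sgnZ e p' s' := by
  unfold checkChunkF at h
  split at h
  · rename_i R T hR hT
    exact altRun_of_checkGapsF (rsTablesWith_valid hR) (RHUpToCert.tablesWith_valid hT) gs p s hp h
  · simp at h

end Literature.NumberTheory.LFunctions.RSCert
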